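import Mathlib

/-!
# T5DatumSigns — the sign bookkeeping of the datum D (N0 (D1), (D4))

Kernel witness (seat p5, cell pub-hodge-repro2, Tier 5) for the elementary sign sentences of
`route/T5-N0-p5.md` (N0.3):

* (D1) «`e_{101} := u·e_{111}`, `e_{110} := u⁻¹·e_{100}` … `e_{101} e_{110} = e_{111} e_{100}`
  exactly» — `mul_mul_inv_mul`;
* (D1) «the real-place signs of the pair `(101, 110)` differ from those of `(111, 100)` exactly
  where `u < 0`» — `sign_mul_eq_iff` / `sign_mul_ne_iff`;
* (D1) «`S_g := {v finite : η_v(u) = −1}` is non-empty of odd cardinality (`η(u) = 1` and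
  `ι₂(u) < 0` is the one real place with `η_{ι₂}(u) = −1`)» — `odd_card_finite_neg` and
  `finite_neg_nonempty`: a family of signs `±1` on a finite set of places with product `1` (the
  product formula) and EXACTLY ONE infinite place carrying `−1` has an ODD number of finite places
  carrying `−1`;
* (D4) «the prescribed invariants have product `∏_{v fin} inv_v(V) · (+1)³ = ∏_{v | ∞} inv_v(V)
  = (+1)(−1)(−1) = +1`» — `prod_finite_eq_prod_infinite`, `prod_infinite_three`,
  `prod_modified_eq_one`: under the product formula the finite product equals the infinite product,
  the infinite product of `(+1, −1, −1)` is `+1`, and the family obtained by replacing every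
  infinite sign by `+1` again has product `+1` (Landherr's condition `∏_v ε_v = +1` for `V′`).

Everything is finite combinatorics of signs in `ℤ`; nothing about fields, Hilbert symbols or
hermitian spaces is asserted (the product formulas themselves are the prose's cited inputs).
A related statement in the cell's annex: p3's `T5Reciprocity.even_ncard_nonNormSet_of_symbolProd_eq_one`
(p389606, «product formula ⟹ |T(d)| even» in the B1 `LocalSymbols` model); here the set of places
is split into finite and infinite ones and the conclusion is the odd cardinality of the finite part.
-/

namespace Summit.Ventures.HodgeRepro2.T5DatumSigns

open Finset

section Signs

variable {ι : Type*} [Fintype ι]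

omit [Fintype ι] in
/-- A sign family (every value `1` or `−1`) takes the value `−1` exactly where it is not `1`. -/
theorem eq_neg_one_iff_ne_one {s : ι → ℤ} (hs : ∀ v, s v = 1 ∨ s v = -1) (v : ι) :
    s v = -1 ↔ s v ≠ 1 := by
  rcases hs v with h | h <;> simp [h]

/-- The product of a sign family (every value `1` or `−1`) is `(−1)^{#(places carrying −1)}`. -/
theorem prod_eq_neg_one_pow_card {s : ι → ℤ} (hs : ∀ v, s v = 1 ∨ s v = -1) :
    ∏ v, s v = (-1) ^ (univ.filter fun v => s v = -1).card := by
  classical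
  rw [← prod_filter_mul_prod_filter_not univ (fun v => s v = -1)]
  have h1 : ∏ v ∈ univ.filter (fun v => s v = -1), s v =
      ∏ _v ∈ univ.filter (fun v => s v = -1), (-1 : ℤ) :=
    prod_congr rfl fun v hv => (mem_filter.mp hv).2
  have h2 : ∏ v ∈ univ.filter (fun v => ¬ s v = -1), s v = 1 :=
    prod_eq_one fun v hv => by
      rcases hs v with h | h
      · exact h
      · exact absurd h (mem_filter.mp hv).2
  rw [h1, h2, prod_const, mul_one]

/-- Product formula ⟹ the number of places carrying `−1` is even. -/
theorem even_card_neg_of_prod_eq_one {s : ι → ℤ} (hs : ∀ v, s v = 1 ∨ s v = -1) (h : ∏ v, s v = 1) :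
    Even (univ.filter fun v => s v = -1).card := by
  rw [prod_eq_neg_one_pow_card hs] at h
  exact (neg_one_pow_eq_one_iff_even (by norm_num)).mp h

variable (fin : ι → Prop) [DecidablePred fin]

/-- The places carrying `−1` split into the finite and the infinite ones. -/
theorem card_neg_eq_card_finite_add_card_infinite (s : ι → ℤ) :
    (univ.filter fun v => s v = -1).card =
      (univ.filter fun v => fin v ∧ s v = -1).card +
        (univ.filter fun v => ¬ fin v ∧ s v = -1).card := by
  classical
  rw [← card_union_of_disjoint]
  · congr 1
    ext v
    simp only [mem_filter, mem_univ, true_and, mem_union]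
    tauto
  · rw [disjoint_left]
    intro v hv hv'
    exact (mem_filter.mp hv').2.1 (mem_filter.mp hv).2.1

/-- (D1), the sentence «`S_g` has odd cardinality»: a sign family with product `1` and exactly
one infinite place carrying `−1` carries `−1` at an odd number of finite places. -/
theorem odd_card_finite_neg {s : ι → ℤ} (hs : ∀ v, s v = 1 ∨ s v = -1) (h : ∏ v, s v = 1)
    (hinf : (univ.filter fun v => ¬ fin v ∧ s v = -1).card = 1) :
    Odd (univ.filter fun v => fin v ∧ s v = -1).card := by
  have he := even_card_neg_of_prod_eq_one hs h
  rw [card_neg_eq_card_finite_add_card_infinite fin s, hinf] at he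
  exact Nat.not_even_iff_odd.mp (Nat.even_add_one.mp he)

/-- (D1), the sentence «`S_g` is non-empty». -/
theorem finite_neg_nonempty {s : ι → ℤ} (hs : ∀ v, s v = 1 ∨ s v = -1) (h : ∏ v, s v = 1)
    (hinf : (univ.filter fun v => ¬ fin v ∧ s v = -1).card = 1) :
    (univ.filter fun v => fin v ∧ s v = -1).Nonempty := by
  rw [← card_pos]
  exact (odd_card_finite_neg fin hs h hinf).pos

end Signs

section D1

/-- (D1): `e_{101} e_{110} = (u e_{111}) (u⁻¹ e_{100}) = e_{111} e_{100}` exactly. -/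
theorem mul_mul_inv_mul {E : Type*} [Field E] {u : E} (hu : u ≠ 0) (e e' : E) :
    (u * e) * (u⁻¹ * e') = e * e' := by
  field_simp

/-- (D1), real-place signs: multiplying by `u` leaves the sign at a place unchanged iff `u` is
positive there (`s_u = 1`). -/
theorem sign_mul_eq_iff {su se : ℤ} (hsu : su = 1 ∨ su = -1) (hse : se = 1 ∨ se = -1) :
    su * se = se ↔ su = 1 := by
  rcases hsu with h | h <;> rcases hse with h' | h' <;> simp [h, h']

/-- (D1), real-place signs: the signs of `u·e` and of `e` differ exactly where `u < 0`
(`s_u = −1`). -/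
theorem sign_mul_ne_iff {su se : ℤ} (hsu : su = 1 ∨ su = -1) (hse : se = 1 ∨ se = -1) :
    su * se ≠ se ↔ su = -1 := by
  rcases hsu with h | h <;> rcases hse with h' | h' <;> simp [h, h']

end D1

section D4

variable {ι : Type*} [Fintype ι] (fin : ι → Prop) [DecidablePred fin]

/-- Product formula ⟹ the finite product equals the infinite product (both are `±1`). -/
theorem prod_finite_eq_prod_infinite {ε : ι → ℤ} (hε : ∀ v, ε v = 1 ∨ ε v = -1) (h : ∏ v, ε v = 1) :
    ∏ v ∈ univ.filter fin, ε v = ∏ v ∈ univ.filter (fun v => ¬ fin v), ε v := by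
  classical
  have hsplit := prod_filter_mul_prod_filter_not univ fin ε
  rw [h] at hsplit
  have hinf : ∏ v ∈ univ.filter (fun v => ¬ fin v), ε v = 1 ∨
      ∏ v ∈ univ.filter (fun v => ¬ fin v), ε v = -1 := by
    refine Finset.prod_induction _ (fun x => x = 1 ∨ x = -1) ?_ (Or.inl rfl) fun v _ => hε v
    rintro a b (ha | ha) (hb | hb) <;> simp [ha, hb]
  rcases hinf with hi | hi
  · rw [hi] at hsplit ⊢
    simpa using hsplit
  · rw [hi] at hsplit ⊢
    linarith

/-- (D4): the three archimedean invariants `(+1, −1, −1)` have product `+1`. -/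
theorem prod_infinite_three : (1 : ℤ) * (-1) * (-1) = 1 := by norm_num

/-- (D4): replacing every infinite sign of a sign family with product `1` and infinite product `1`
by `+1` gives a family with product `1` (Landherr's condition for the positive definite `V′`). -/
theorem prod_modified_eq_one {ε : ι → ℤ} (hε : ∀ v, ε v = 1 ∨ ε v = -1) (h : ∏ v, ε v = 1)
    (hinf : ∏ v ∈ univ.filter (fun v => ¬ fin v), ε v = 1) :
    ∏ v, (if fin v then ε v else 1) = 1 := by
  classical
  rw [← prod_filter_mul_prod_filter_not univ fin]
  have h1 : ∏ v ∈ univ.filter fin, (if fin v then ε v else 1) = ∏ v ∈ univ.filter fin, ε v :=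
    prod_congr rfl fun v hv => if_pos (mem_filter.mp hv).2
  have h2 : ∏ v ∈ univ.filter (fun v => ¬ fin v), (if fin v then ε v else 1) = 1 :=
    prod_eq_one fun v hv => if_neg (mem_filter.mp hv).2
  rw [h1, h2, mul_one, prod_finite_eq_prod_infinite fin hε h, hinf]

end D4

end Summit.Ventures.HodgeRepro2.T5DatumSigns
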